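import Summits.BirchSwinnertonDyer.BirchSwinnertonDyer.Theses.ManinLocalTwoThree
import Summits.BirchSwinnertonDyer.BirchSwinnertonDyer.Theses.TwistFamilyManinDescent
import Summits.BirchSwinnertonDyer.BirchSwinnertonDyer.Theorems.ManinLocalTwoThreeManinPrimeToAdditiveFiveLeOptimalPartner
import Summits.BirchSwinnertonDyer.BirchSwinnertonDyer.Theorems.ManinLocalTwoThreeManinPrimeToAdditiveFiveLeStrongIsUnstarredOfAcrossIsogeny
import Summits.BirchSwinnertonDyer.BirchSwinnertonDyer.Theorems.ManinLocalTwoThreeManinPrimeToAdditiveFiveLeLedgerFivePrints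
import Summits.BirchSwinnertonDyer.BirchSwinnertonDyer.Theorems.ManinLocalTwoThreeManinPrimeToAdditiveFiveLeLedgerFourPrints
import Summits.BirchSwinnertonDyer.BirchSwinnertonDyer.Theorems.ManinLocalTwoThreeManinPrimeToAdditiveFiveLeLedgerFourPrintsNoDD
import Summits.BirchSwinnertonDyer.BirchSwinnertonDyer.Theorems.ManinLocalTwoThreeManinPrimeToAdditiveFiveLeLedgerResidual
import Summits.BirchSwinnertonDyer.BirchSwinnertonDyer.Theorems.TwistFamilyManinDescentOrdinaryCornerOfSerreTateDepth
import HarnessLib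

/-!
# Crux `ManinPrimeToAdditiveFiveLe` (stmt-BirchSwinnertonDyer-22969) — line `upper-anchor`, skeleton v17
# (lead gen 8, 2026-08-28): MODULO THE FOUR PRINTS, C5 **IS** ROUTE `TwistFamilyManinDescent`'s DECLARED RESIDUAL R (stmt-25138)

v17 = v16 with the six by-name leaf stubs COLLAPSED onto the one registered item they decompose: `stub_residual` := R
`TwistFamilyManinDescent.EisensteinAdditiveManinResidual` (stmt-BirchSwinnertonDyer-25138, [difficulty: open-problem] — Manin's conjecture at the
Eisenstein additive primes `5, 7, 13`: `W[p]` reducible, `W ⊗ p*` still additive, lattice-optimal datum ⇒ `p ∤ c`). The lead's gen-8 helper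
`Theorems/…LedgerResidual.lean` proves **`maninPrimeToAdditiveFiveLe_iff_residual_of_fourPrints` : granted {F″, EdK, EdG, MazurJ}, C5 ↔ R** —
`C5 ⟸ prints ∧ R` by the width seat's Kato reduction (p611587) with the irreducible locus from modularity ∧ F″ (`coreKP_of_kato`), the reducible
twist-minimal residual read at `p ∈ {5, 7, 13}` on R ITSELF (twist-additivity = the line's odd twist-minimality) and at `p ≥ 11`, `p ≠ 13` on Edixhoven's
two printed forms off the (G)-ordinary unstarred rows, which Mazur's `j`-list empties (`not_dvd_c_large_of_not_typeGOrd_unstarred` — the branch of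
pub/bsd-wall's `not_dvd_c_large` that never reaches the `13`-trichotomy); `R ⟸ C5` literally. CONSEQUENCE: the three ORIENTATION leaves of v13–v16 —
K15a `SupersingularStrongIsUnstarred` (27072), I9 `OrdinaryCornerOptimalSerreTateDeep` (27660), C2 `EisensteinOrdinaryStrongIsTop` (26929), none implied by
C5 (p632301 / p638426) — were artefacts of the ROW DISPATCH at `5, 7` and of the lattice TRICHOTOMY at `13`, not of C5, and LEAVE its path of record;
so do Ihara³, Cremona's table and `LargePrimeReducibleJ` (25139) of TFMD's `Assembly` book (`…OfTwistFamilyLedger.lean`). Stubs (2): `stub_printedInputs`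
[4 cite-only: F″, EdK, EdG, MazurJ; NOT a prover target] / `stub_residual` [R 25138 BY NAME; OPEN, owned by route `TwistFamilyManinDescent`, SPLIT there
into the seven leaves]. Composition `ManinPrimeToAdditiveFiveLe_of` := `maninPrimeToAdditiveFiveLe_of_fourPrints_of_residual`. The SEVEN-LEAF book of
v16 is kept as the THEOREM `ManinPrimeToAdditiveFiveLe_of_sevenLeaves` (leaves as hypotheses, p640646) and `residual_of_sevenLeaves` records that TFMD's
split suffices for R modulo the same prints. The line `upper_anchor` AS A REDUCTION IS COMPLETE: C5's open content on its path of record is exactly the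
item R. C5 is NOT proved; R is NOT proved; BSD is not proved by any of this; registering a skeleton books nothing.


## v16 card (lead gen 7) — FOUR PRINTS ∧ THE SEVEN LEAVES — kept as the ALTERNATIVE book (theorem `ManinPrimeToAdditiveFiveLe_of_sevenLeaves` below)

v16 = v15 with `stub_printedInputs` 5 → 4 conjuncts {Kato F″, Edixhoven Thm. 3 Kodaira half, Edixhoven Thm. 3 ordinarity half, Mazur's `j`-list}: the width
seat -w2 (gen 6) PROVED Dokchitser–Dokchitser 2015 Thm. 5.1 (1), clause `l = p`, on the whole (G)-locus `e ∣ p − 1` for EVERY ℚ-isogeny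
(`padicValInt_minimalDiscriminantInt_eq_of_isIsogenous_of_typeG`, `Theorems/…IsogenyMinimalDiscriminantRigidity.lean` p639486: prime step = Coates'
congruence / the discharged `l ≠ p` clause, strong induction over cyclic isogenies through global minimal models, `Isogeny.exists_isCyclic_degree_dvd` for
arbitrary isogenies) and re-keyed pub/bsd-wall's `13`-core and the lead's starred-rows reduction WITHOUT the cite-only fact (p639943, p640151, p640646).
Composition `ManinPrimeToAdditiveFiveLe_of` := -w2's `maninPrimeToAdditiveFiveLe_of_fourPrints_of_sevenLeaves` (`Theorems/…LedgerFourPrintsNoDD.lean`, p640646;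
kernel audit: proof.conditional on EXACTLY the four Literature facts). Stubs (6, unchanged from v15 but for the prints): `stub_printedInputs` [4 cite-only;
NOT a target] / `stub_ss57` [K15b 27071] / `stub_strongIsUnstarred57` [K15a 27072] / `stub_ordinaryCornerLeaves` [I9 27660 ∧ K18a″ 27661 ∧ K18b″ 27662] /
`stub_notBottom13` [C1 25939] / `stub_strongIsTop13` [C2 26929]. So C5 BY NAME ⟸ {F″, EdK, EdG, MazurJ} ∧ THE SEVEN LEAVES of route `TwistFamilyManinDescent`,
in BOTH books (the E-imc-9(13) book, theorem `ManinPrimeToAdditiveFiveLe_of_ordinaryTwistLaw13`, has the same four prints). Gen-7 print eliminations: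
GK (v13), ČNS + Cremona (v14), D–D (v16). C5 is NOT proved; no leaf is proved here; BSD is not proved by any of this; registering a skeleton books nothing.

## v15 card (lead gen 7, earlier) — THE SEVEN LEAVES AS REGISTERED STUBS — kept

v15 = v14 with `stub_ord57` (`OrdinaryCornerManinResidual`, stmt-27552 — an ASSEMBLED node of route `TwistFamilyManinDescent` since its LINE 18R) replaced by
the conjunction of its three LEAVES BY NAME, `stub_ordinaryCornerLeaves` := I9 `OrdinaryCornerOptimalSerreTateDeep` (27660) ∧ K18a″
`OrdinaryCornerDeepEdixhovenDichotomy` (27661) ∧ K18b″ `OrdinaryCornerDeepUnstarredNotBottom` (27662); stmt-27552 is the THEOREM `ord57_of_leaves` inside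
(pub/bsd-wall's glue `TwistFamilyManinDescent.ordinaryCornerOfSerreTateDepth_proof`, stmt-27664, fed with the lead's `ordinaryCornerOffTable_proof`,
stmt-27663, p636035). So the registered stubs now ARE the seven leaves of C5: `stub_printedInputs` [5 cite-only: F″, EdK, EdG, MazurJ, D–D; NOT a target] /
`stub_ss57` [K15b 27071] / `stub_strongIsUnstarred57` [K15a 27072] / `stub_ordinaryCornerLeaves` [I9 27660 ∧ K18a″ 27661 ∧ K18b″ 27662] / `stub_notBottom13`
[C1 25939] / `stub_strongIsTop13` [C2 26929]; composition `ManinPrimeToAdditiveFiveLe_of` := `maninPrimeToAdditiveFiveLe_of_fivePrints_of_sevenLeaves`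
(`Theorems/…LedgerFivePrints.lean`, p637045). CLASSIFICATION of the leaves (kernel-certified, `Theorems/…LeavesOfC5.lean` p638426 + the lead's gen-6
p632301): K15b, K18a″ (vacuously), K18b″, C1 are SPECIAL CASES of C5; exactly K15a, I9, C2 are ORIENTATION laws not implied by C5. REFINEMENTS landed this
gen: the STARRED ordinary rows ride the unstarred ones granted D–D (`…OrdinaryCornerOfUnstarredRows.lean`, p638809 — I9 / K18a″ matter only on (5;3),
(7;2), (7;4)); K18b″ ⟺ horocyclic witnesses H57′ and C1 ⟺ witnesses (width seat -w3 g3, p638420 / p638660, from bsd-idea-8's line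
«horocyclic-orientation», whose support stub is PROVED, p637599, and whose programme HorocyclicOffResidue / HorocyclicResidualAvoidance is the live
mechanism for the two NOT-BOTTOM leaves). ALTERNATIVE BOOK (theorem `ManinPrimeToAdditiveFiveLe_of_ordinaryTwistLaw13` inside): FOUR prints {F″, EdK, EdG,
MazurJ} ∧ K15b ∧ 27552 ∧ K15a ∧ E-imc-9 `OrdinaryRamifiedTwistLaw 13` (width seat -w4 g2, `…LedgerFourPrints.lean` p636120) — D–D and C1 ∧ C2 traded for
the imc cell's unregistered conjecture at 13. C5 is NOT proved; no leaf is proved here; BSD is not proved by any of this; registering a skeleton books nothing.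

## v14 card (lead gen 7, earlier) — ONE BOOK, FIVE PRINTS — kept

v14 = v13 with `stub_printedInputs` 7 → 5 conjuncts {Kato F″, Edixhoven Thm. 3 Kodaira half, Edixhoven Thm. 3 ordinarity half, Mazur's `j`-list,
Dokchitser–Dokchitser 2015 Thm. 5.1 (1)}: the registered items that carry the `W[p]`-reducible residual (K15a, K15b, stmt-27552 at `p ∈ {5, 7}`;
C1, C2 at `13`) have NO level cut and NO degree cut, so the Cremona cut `N > 5·10⁵` and the ČNS cut `p ∣ deg φ` of RED(57♯)/RED(13♯) are idle —
`Theorems/…LedgerFivePrints.lean` (`maninPrimeToAdditiveFiveLe_of_fivePrints_of_items`, lead gen 7): `p ∈ {5, 7}` by route `TwistFamilyManinDescent`'s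
row dispatch (Ray57 ⟸ K15a ∧ K15b by the closed glue stmt-27096; Corner57 ⟸ T17 ∧ 27552 ∧ K15a ∧ Ray57 by the closed glue stmt-27553, T17 =
`SupersingularCornerTwistTransport` stmt-27551 PROVED this gen, p635594), `p > 7` by pub/bsd-wall's `not_dvd_c_large` (p620618) with Mazur's
`j`-list emptying the (G)-ordinary unstarred rows off `13`. Gen-7 landings on the shared residual: T17 stmt-27551 (p635594), its bundle stmt-27665
(closed by name), `OrdinaryCornerOffTable` stmt-27663 (p636035) — three TFMD items CLOSED; with pub/bsd-wall's glues 27553 / 27664 the open content of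
C5 in EITHER book is exactly THE SEVEN LEAVES {K15a 27072, K15b 27071, I9 27660, K18a″ 27661, K18b″ 27662, C1 25939, C2 26929} ∪ the five prints
(`Theorems/…LedgerSevenLeaves.lean`, `…LedgerFivePrints.lean`). Stubs of v14 (6 ≤ stubs_max): `stub_printedInputs` [5 cite-only; NOT a prover target] /
`stub_ss57` [27071] / `stub_ord57` [27552 = I9 ∧ K18a″ ∧ K18b″ by glue 27664 + OffTable] / `stub_strongIsUnstarred57` [27072] / `stub_notBottom13` [25939] /
`stub_strongIsTop13` [26929]. C5 is NOT proved; no leaf is proved here; BSD is not proved by any of this; registering a skeleton books nothing.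

## v13 card (lead gen 7, earlier) — ONE BOOK: every open input a registered item of route `TwistFamilyManinDescent` — kept

v13 = v12 with BOTH remaining non-item stubs re-socketed BY NAME onto registered, refuter-vetted ITEMS of route
`TwistFamilyManinDescent` (integration of the width seat's ψ p633129 / `…StrongIsUnstarredOfAcrossIsogeny.lean` and of
pub/bsd-wall's p621027 `coreRED13_of_notBottom_of_strongIsTop`; no new mathematics in the re-socketing):
* `stub_acrossIsogeny57` (E-imc-5 `OptimalUnstarredAcrossIsogeny 5 ∧ 7`, a bare `@[conjecture]` def) ↦ `stub_strongIsUnstarred57` :=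
  K15a `TwistFamilyManinDescent.SupersingularStrongIsUnstarred` (stmt-BirchSwinnertonDyer-27072) — a WEAKENING of hypotheses
  (ψ §1: K15a ⟸ modularity ∧ Gealy–Klagsbrun ∧ E-imc-5(5) ∧ E-imc-5(7)); CORNER(5; II) and the starred reducible residue at
  `5, 7` are THEOREMS from K15a ∧ K15b ∧ stmt-27552 (ψ part 1, `cornerTypeIIAtFive_of_strongIsUnstarred`,
  `coreRED57starred_of_twistFamilyItems`); Gealy–Klagsbrun 2017 LEAVES the cone.
* `stub_ordinaryTwistLaw13` (E-imc-9 `OrdinaryRamifiedTwistLaw 13`, a bare `@[conjecture]` def) ↦ `stub_notBottom13` := C1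
  `TwistFamilyManinDescent.EisensteinOrdinaryTwistLatticeNotBottom` (stmt-BirchSwinnertonDyer-25939) ∧ `stub_strongIsTop13` := C2
  `TwistFamilyManinDescent.EisensteinOrdinaryStrongIsTop` (stmt-BirchSwinnertonDyer-26929): the `W[13]`-reducible core RED(13) is the
  THEOREM `coreRED13_of_notBottom_of_strongIsTop` (TFMD's lattice trichotomy `i ∈ {1, 13, 13²}` for `(f, f ⊗ χ₁₃)` read from the
  unstarred optimal curve: BOTTOM excluded by C1, MIDDLE by C2 + the Néron-scalar dichotomy, TOP ⟹ `W ⊗ 13* ≅` the optimal twin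
  and `c = ±c′`, `13 ∤ c′` by Edixhoven's Kodaira half on the starred twin) GRANTED Dokchitser–Dokchitser 2015 Thm. 5.1 (1)
  (type rigidity under isogeny at a potentially ordinary prime), which RE-ENTERS `stub_printedInputs` as conjunct 7 (cite-only
  `dokchitser_padicValInt_minimalDiscriminantInt_eq_of_isogeny_of_potentiallyGoodOrdinary`; a `_holds` is being built by seat
  bsd-line-ttd-p1 along the Vélu–Coates road — when it lands the conjunct is discharged by `exact`).
Stubs of v13 (6 ≤ stubs_max): `stub_printedInputs` [7 cite-only: F″, ČNS, Cremona ≤ 5·10⁵, EdK, EdG, MazurJ, D–D; NOT a prover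
target] / `stub_ss57` [stmt-27071] / `stub_ord57` [stmt-27552] / `stub_strongIsUnstarred57` [stmt-27072] / `stub_notBottom13`
[stmt-25939] / `stub_strongIsTop13` [stmt-26929]. Composition `ManinPrimeToAdditiveFiveLe_of` = the width seat's
`maninPrimeToAdditiveFiveLe_of_sevenPrints_of_twistFamilyItems` (ψ §4). So C5 BY NAME ⟸ {7 prints} ∧ FIVE registered items of
route `TwistFamilyManinDescent` — the «single book» the gen-6 ORIENTATION note asked for: the two decompositions of C5
(this line; TFMD's closed `Assembly` over `EisensteinAdditiveManinResidual`) now have THE SAME open leaves at every prime.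
ALTERNATIVE at 13 (recorded, not registered): ψ §3 `maninPrimeToAdditiveFiveLe_of_sixPrints_of_twistFamilyItems_of_ordinaryTwistLaw`
keeps E-imc-9(13) in place of C1 ∧ C2 ∧ D–D (then SIX prints); E-imc-9(13) ⟹ C1(13) is the width seat's p631346, E-imc-9(13) and
C2(13) are incomparable (degree law along the twist orbit vs. Stevens' étale exit from the optimal curve).
C5 is NOT proved; none of 27071 / 27552 / 27072 / 25939 / 26929 is proved here; BSD is not proved by any of this;
registering a skeleton books nothing.

## v12 / v11 / v10 cards (lead gen 6), compressed — full text in the tree history of this file (commit dc7e8c65b805) and in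
## `Cruxes/…/LEDGER-upper-anchor.md`

v12: `stub_printedInputs` 8 → 7 (Dokchitser–Dokchitser dropped; starred residue read on 27552/(U), p630701); v11: KP57 (stmt-23810)
ELIMINATED from the cone by pub/bsd-wall's `TeichmullerTwistDescent.not_dvd_c_of_kato` (irreducible additive locus at `p ≥ 5` ⟸
modularity ∧ F″), the potentially ORDINARY reducible cells (7;IV), (5;III), (7;II) ↦ stmt-27552 BY NAME; v10: SS rows (5;IV), (7;III) ↦
K15b stmt-27071 BY NAME, law (U) ↦ E-imc-5(5,7) ∧ GK, DegreeUp13Red ↦ E-imc-9(13). v9 (gen 5): the anchor stub = three Raynaud cells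
(Ogg–Tate split, p625709). v8/v7 (gen 4): the (5;II) cell rides its FLIP twin (p622240), corners ⟸ (U) (p623176, p621355). v6/v5 (gen 3):
RED(57♯) split by Kodaira side (θ), RED(13♯) ⟸ EdK ∧ DegreeUp13Red (p618203). v4 (gen 2): stubs = typed residual. v1–v3 (ideator
bsd-idea-8 + gens 0/1): upper anchor + direction law; `stub_optimalPartner` PROVED (p606476).
Target BY NAME: `Summit.BirchSwinnertonDyer.BirchSwinnertonDyer.Theses.ManinLocalTwoThree.ManinPrimeToAdditiveFiveLe`.
-/

/-! ## History (v1–v3, ideator bsd-idea-8 + lead gen 0/1) — pointer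

The original line card («upper anchor»: Edixhoven 1991 Thm. 3 as near-miss; the an-cell's PROVED near-invariance
`pStar_optimal_commuting_manin_near_invariance` closing C5 from an UPPER ANCHOR on the starred member of a commuting
optimal `χ_{p*}`-pair plus a DIRECTION LAW; stubs `stub_optimalPartner` [PROVED p606476], `stub_upperAnchor`,
`stub_directionLawIrr`, `stub_reducibleTwistMinimal`, all closed MODULO named facts by gens 1–2) is kept verbatim in
the tree history of this file (commit eb90aa6b1e0b, skeleton v6) and in `Cruxes/…/LEDGER-upper-anchor.md`.
-/

set_option autoImplicit false
set_option linter.dupNamespace false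

noncomputable section

open scoped Classical NumberField

open WeierstrassCurve IsDedekindDomain NumberField Literature.NumberTheory.EllipticCurves
  Literature.NumberTheory.EllipticCurves.ModularForms
  Summit.BirchSwinnertonDyer.Rank1Residual.ManinAdditive
  Summit.BirchSwinnertonDyer.BirchSwinnertonDyer.Theses.EdixhovenFibreFiveSeven
  Summit.BirchSwinnertonDyer.BirchSwinnertonDyer.Theorems

namespace Summit.BirchSwinnertonDyer.BirchSwinnertonDyer.Cruxes.ManinPrimeToAdditiveFiveLe.UpperAnchor

/-- v3 STUB 1 — CLOSED (p606476, width seat): the commuting optimal `p*`-partner. Kept for the record;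
not used by the composition since v4. [cite: Watkins2002, §2.1] -/
theorem stub_optimalPartner :
    exists_isNewformOf →
    ∀ {p : ℕ}, p.Prime → 5 ≤ p →
    ∀ (W : WeierstrassCurve ℚ) [W.IsElliptic] [W.IsGloballyMinimal] [NeZero (W.conductorNorm ℤ)]
      (D : ModularParametrizationData W (W.conductorNorm ℤ)),
      IsLatticeOptimal D → p ^ 2 ∣ W.conductorNorm ℤ →
      ¬ (∃ (W' : WeierstrassCurve ℚ), W'.IsElliptic ∧ W'.IsGloballyMinimal ∧
          IsIsogenous W (W'.quadraticTwist (((-1 : ℤ) ^ (p / 2) * p : ℤ) : ℚ)) ∧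
          ¬ p ^ 2 ∣ W'.conductorNorm ℤ) →
      W.HasIrreducibleModPGaloisRep p →
      ∃ (W' : WeierstrassCurve ℚ) (_ : W'.IsElliptic) (_ : W'.IsGloballyMinimal)
        (_ : NeZero (W'.conductorNorm ℤ)) (u : VariableChange ℚ)
        (D' : ModularParametrizationData W' (W'.conductorNorm ℤ)),
        IsLatticeOptimal D' ∧ W'.conductorNorm ℤ = W.conductorNorm ℤ ∧
        u • W.quadraticTwist ((((-1 : ℤ) ^ (p / 2) * p : ℤ)) : ℚ) = W' :=
  -- CLOSED (width seat -w2, p606476): tree theorem, verbatim signature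
  Summit.BirchSwinnertonDyer.BirchSwinnertonDyer.Theorems.stub_optimalPartner

/-- STUB P — **the printed inputs** (FOUR cite-only Literature facts as ONE conjunction; NOT a prover target — each conjunct is a
statement-only `def … : Prop` that closes only by an XL `_holds` port under `Literature/`). v16: D–D 2015 Thm. 5.1 (1) LEAVES (a THEOREM on the
(G)-locus, -w2 p639486); v14: ČNS Thm. 1.2 and Cremona's table LEFT; v13: Gealy–Klagsbrun LEFT. Conjuncts: Kato F″
`kato_neron_isIntegral_twistedSymbolSum_of_additive_five_le` (Kato (8.1.3)/9.7/6.6 + Kim–Nakamura 2.4 + Kosters–Pannekoek Thm 1,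
referee-flagged derived reading), Edixhoven 1991 Thm 3 (Kodaira half, ordinarity half), Mazur 1978 Thm 1 with the rational points of `X₀(p)`.
[cite: Kato2004Asterisque, (8.1.3) (p. 180), Thm. 9.7 (p. 189)] [cite: EdixhovenManin1991, Thm. 3] [cite: Mazur1978, Thm. 1] -/
theorem stub_printedInputs :
    kato_neron_isIntegral_twistedSymbolSum_of_additive_five_le ∧
    edixhoven_not_dvd_maninConstant_of_kodairaSymbol_ne ∧
    edixhoven_not_dvd_maninConstant_of_not_potentiallyGoodOrdinary ∧
    mazur_j_mem_of_not_hasIrreducibleModPGaloisRep_of_eleven_le := by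
  sorry

/-- STUB R (v17) — **route `TwistFamilyManinDescent`'s DECLARED RESIDUAL BY NAME** (`TwistFamilyManinDescent.EisensteinAdditiveManinResidual`,
stmt-BirchSwinnertonDyer-25138, planner bsd-idea-3; [difficulty: open-problem]): given the three printed semistable facts and modularity, for `W/ℚ`
globally minimal with a datum `D` at any level `N`, `p ∈ {5, 7, 13}` (or `p = 163 ∧ 2⁶ ∣ N`) with `p² ∣ N`, `W[p]` REDUCIBLE, `W ⊗ p*` NOT semistable
at `p` and `Λ_W ⊆ c·Λ_f`: `p ∤ c`. Modulo the four prints this IS C5 (`maninPrimeToAdditiveFiveLe_iff_residual_of_fourPrints`, lead gen 8). OPEN; owned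
there; SPLIT there (gen 1 and LINES 12–18R) into the seven leaves {K15a 27072, K15b 27071, I9 27660, K18a″ 27661, K18b″ 27662, C1 25939, C2 26929} —
which suffice (`residual_of_sevenLeaves` below) but three of which (K15a, I9, C2) are orientation laws stronger than what R needs. Census `N ≤ 5·10⁵`:
all `c = 1` (Cremona). [cite: EdixhovenManin1991, Thm. 3 and §4] [cite: Mazur1978, Thm. 1] -/
theorem stub_residual :
    Summit.BirchSwinnertonDyer.BirchSwinnertonDyer.Theses.TwistFamilyManinDescent.EisensteinAdditiveManinResidual := by
  sorry

/-- COMPOSITION (sorry-free outside the two v17 stubs): crux C5 `ManinPrimeToAdditiveFiveLe` BY NAME ⟸ the four prints ∧ R — the lead's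
`maninPrimeToAdditiveFiveLe_of_fourPrints_of_residual` (`Theorems/…LedgerResidual.lean`, gen 8): the `W[p]`-IRREDUCIBLE locus from modularity ∧ F″
alone (`coreKP_of_kato`, via pub/bsd-wall's `TeichmullerTwistDescent.not_dvd_c_of_kato`), the REDUCIBLE twist-minimal residual from R at `p ∈ {5, 7, 13}`
and from EdK ∧ EdG ∧ MazurJ at `p ≥ 11`, `p ≠ 13` (`reducibleTwistMinimal_of_threePrints_of_residual`), assembled by the width seat's Kato reduction
`maninLocalTwoThree_maninPrimeToAdditiveFiveLe_of_kato57_of_cores` (p611587). -/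
theorem ManinPrimeToAdditiveFiveLe_of :
    Summit.BirchSwinnertonDyer.BirchSwinnertonDyer.Theses.ManinLocalTwoThree.ManinPrimeToAdditiveFiveLe :=
  maninPrimeToAdditiveFiveLe_of_fourPrints_of_residual stub_printedInputs.1 stub_printedInputs.2.1 stub_printedInputs.2.2.1
    stub_printedInputs.2.2.2 stub_residual

/-- The v16 SEVEN-LEAF BOOK, recorded as a THEOREM (leaves as hypotheses, not stubs): C5 BY NAME ⟸ the four prints ∧ {K15a 27072, K15b 27071,
I9 27660, K18a″ 27661, K18b″ 27662, C1 25939, C2 26929} (width seat -w2, `maninPrimeToAdditiveFiveLe_of_fourPrints_of_sevenLeaves`, p640646).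
[cite: EdixhovenManin1991, Thm. 3 and §4] -/
theorem ManinPrimeToAdditiveFiveLe_of_sevenLeaves
    (hK15a : Summit.BirchSwinnertonDyer.BirchSwinnertonDyer.Theses.TwistFamilyManinDescent.SupersingularStrongIsUnstarred)
    (hK15b : Summit.BirchSwinnertonDyer.BirchSwinnertonDyer.Theses.TwistFamilyManinDescent.SupersingularUnstarredStrongManinUnit)
    (hI9 : Summit.BirchSwinnertonDyer.BirchSwinnertonDyer.Theses.TwistFamilyManinDescent.OrdinaryCornerOptimalSerreTateDeep)
    (hKa : Summit.BirchSwinnertonDyer.BirchSwinnertonDyer.Theses.TwistFamilyManinDescent.OrdinaryCornerDeepEdixhovenDichotomy)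
    (hKb : Summit.BirchSwinnertonDyer.BirchSwinnertonDyer.Theses.TwistFamilyManinDescent.OrdinaryCornerDeepUnstarredNotBottom)
    (hC1 : Summit.BirchSwinnertonDyer.BirchSwinnertonDyer.Theses.TwistFamilyManinDescent.EisensteinOrdinaryTwistLatticeNotBottom)
    (hC2 : Summit.BirchSwinnertonDyer.BirchSwinnertonDyer.Theses.TwistFamilyManinDescent.EisensteinOrdinaryStrongIsTop) :
    Summit.BirchSwinnertonDyer.BirchSwinnertonDyer.Theses.ManinLocalTwoThree.ManinPrimeToAdditiveFiveLe :=
  maninPrimeToAdditiveFiveLe_of_fourPrints_of_sevenLeaves stub_printedInputs.1 stub_printedInputs.2.1 stub_printedInputs.2.2.1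
    stub_printedInputs.2.2.2 hK15a hK15b hI9 hKa hKb hC1 hC2

/-- TFMD's split SUFFICES for R modulo the same four prints: the seven leaves ⟹ C5 (previous theorem) ⟹ R
(`eisensteinAdditiveManinResidual_of_maninPrimeToAdditiveFiveLe`). [cite: EdixhovenManin1991, Thm. 3 and §4] -/
theorem residual_of_sevenLeaves
    (hK15a : Summit.BirchSwinnertonDyer.BirchSwinnertonDyer.Theses.TwistFamilyManinDescent.SupersingularStrongIsUnstarred)
    (hK15b : Summit.BirchSwinnertonDyer.BirchSwinnertonDyer.Theses.TwistFamilyManinDescent.SupersingularUnstarredStrongManinUnit)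
    (hI9 : Summit.BirchSwinnertonDyer.BirchSwinnertonDyer.Theses.TwistFamilyManinDescent.OrdinaryCornerOptimalSerreTateDeep)
    (hKa : Summit.BirchSwinnertonDyer.BirchSwinnertonDyer.Theses.TwistFamilyManinDescent.OrdinaryCornerDeepEdixhovenDichotomy)
    (hKb : Summit.BirchSwinnertonDyer.BirchSwinnertonDyer.Theses.TwistFamilyManinDescent.OrdinaryCornerDeepUnstarredNotBottom)
    (hC1 : Summit.BirchSwinnertonDyer.BirchSwinnertonDyer.Theses.TwistFamilyManinDescent.EisensteinOrdinaryTwistLatticeNotBottom)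
    (hC2 : Summit.BirchSwinnertonDyer.BirchSwinnertonDyer.Theses.TwistFamilyManinDescent.EisensteinOrdinaryStrongIsTop) :
    Summit.BirchSwinnertonDyer.BirchSwinnertonDyer.Theses.TwistFamilyManinDescent.EisensteinAdditiveManinResidual :=
  eisensteinAdditiveManinResidual_of_maninPrimeToAdditiveFiveLe
    (ManinPrimeToAdditiveFiveLe_of_sevenLeaves hK15a hK15b hI9 hKa hKb hC1 hC2)

/-- The ALTERNATIVE BOOK at 13, recorded as a THEOREM (not a stub): with the imc cell's E-imc-9 `OrdinaryRamifiedTwistLaw 13` in place of C1 ∧ C2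
the composition needs the SAME four prints {F″, EdK, EdG, MazurJ} ∧ K15b ∧ 27552 ∧ K15a (width seat -w4 g2,
`maninPrimeToAdditiveFiveLe_of_fourPrints_of_twistFamilyItems_of_ordinaryTwistLaw`, p636120). [cite: EdixhovenManin1991, Thm. 3] [cite: Watkins2002, §2.1] -/
theorem ManinPrimeToAdditiveFiveLe_of_ordinaryTwistLaw13 (hO13 : OrdinaryRamifiedTwistLaw 13)
    (hK15a : Summit.BirchSwinnertonDyer.BirchSwinnertonDyer.Theses.TwistFamilyManinDescent.SupersingularStrongIsUnstarred)
    (hK15b : Summit.BirchSwinnertonDyer.BirchSwinnertonDyer.Theses.TwistFamilyManinDescent.SupersingularUnstarredStrongManinUnit)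
    (hOrd : Summit.BirchSwinnertonDyer.BirchSwinnertonDyer.Theses.TwistFamilyManinDescent.OrdinaryCornerManinResidual) :
    Summit.BirchSwinnertonDyer.BirchSwinnertonDyer.Theses.ManinLocalTwoThree.ManinPrimeToAdditiveFiveLe :=
  maninPrimeToAdditiveFiveLe_of_fourPrints_of_twistFamilyItems_of_ordinaryTwistLaw stub_printedInputs.1 stub_printedInputs.2.1
    stub_printedInputs.2.2.1 stub_printedInputs.2.2.2 hK15b hOrd hK15a hO13

end Summit.BirchSwinnertonDyer.BirchSwinnertonDyer.Cruxes.ManinPrimeToAdditiveFiveLe.UpperAnchor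

end
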